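/-
Copyright (c) 2026 Harness contributors. All rights reserved.
Released under Apache 2.0 license as described in the file LICENSE.
-/
import Mathlib
import Summits.NavierStokesRegularity.NavierStokesRegularity.Theorems.EulerZoomLiouvillePowerGaugeEulerLiouvilleSelfSimilarSourceNodeDichotomous
import Literature.Analysis.ODE.RealMatrixExponentialGrowth
import HarnessLib

/-!
# No vorticity near a hyperbolic SOURCE of the self-similar transport field (`γ < 1/2`)

Helper toward crux **E** `stmt-NavierStokesRegularity-19832`
(`Summit.NavierStokesRegularity.NavierStokesRegularity.Theses.EulerZoomLiouville.PowerGaugeEulerLiouville`),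
completing the linear-algebra side (L) of typeII-p3's crux idea «hyperbolic-stagnation exclusion»
begun in `…SelfSimilarSourceNode.lean` (p546408) and `…SelfSimilarSourceNodeDichotomous.lean`
(p550967).  There the hypothesis on the stagnation point `y*` of `W = γy + V` was an exponential
dichotomy of `e^{tDW(y*)}`, resp. the spectrum of an abstract complexification.  Here it is the
hypothesis one actually checks: the complex roots of the CHARACTERISTIC POLYNOMIAL of the standard
`3 × 3` matrix of `DW(y*) = γ·id + DV(y*)`
(`Literature.Analysis.ODE.exists_complexification`, Khalil (4.11)):

* `curl_eq_zero_near_charpolySourceNode` — roots in a strip `a < Re μ < b`, `0 < a ≤ b < 1 + γ` ⇒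
  `curl V ≡ 0` on a ball around `y*`;
* `curl_eq_zero_near_hyperbolicSourceNode` — **`γ < 1/2` and all roots with `Re μ > 0` (a hyperbolic
  source) ⇒ `curl V ≡ 0` on a ball around `y*`**: the roots sum to `tr DW(y*) = 3γ + div V(y*) = 3γ`
  (`V` divergence free, `Matrix.trace_eq_sum_roots_charpoly_of_splits`), so `0 < Re μ < 3γ < 1 + γ`.

So a classical profile refuting the crux in the window `0 < γ < 1/2` has NO hyperbolic source among
its stagnation points adherent to `{Ω ≠ 0}`; sinks are impossible outright (`tr = 3γ > 0`); what the
idea still needs is the dynamical half (M): finiteness + hyperbolicity of the stagnation set forces a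
dense set of backward orbits into sources.

## References

* P. Constantin, M. Ignatova, V. Vicol, *On putative self-similar solutions of 3D Euler*,
  arXiv:2608.09592 (2026), §3.5 Prop. 3.9. [ConstantinIgnatovaVicol2026Putative]
* H. K. Khalil, *Nonlinear Systems*, 3rd ed., 2002, §4.3 (4.11), Thm 4.6. [Khalil2002]
-/

noncomputable section

-- flat `Theorems/<Route><Decl>…` files of one crux share the namespace of the crux (tree convention)
set_option linter.dupNamespace false

open MeasureTheory Set Filter Topology Metric Function InnerProductSpace NormedSpace
open scoped RealInnerProductSpace NNReal ContDiff

namespace Summit.NavierStokesRegularity.NavierStokesRegularity.Theorems.PowerGaugeEulerLiouville.Kelvin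

open Literature.Analysis Literature.Analysis.FluidPDE

variable {γ : ℝ} {V : EuclideanSpace ℝ (Fin 3) → EuclideanSpace ℝ (Fin 3)} {P : EuclideanSpace ℝ (Fin 3) → ℝ}

/-- **Vorticity vanishes near a source node given by the CHARACTERISTIC POLYNOMIAL.**  Same as
`curl_eq_zero_near_spectralSourceNode`, with the canonical complexification of `ℝ³`
(`Literature.Analysis.ODE.exists_complexification`): if every complex root `μ` of the characteristic
polynomial of the standard matrix of `A = γ·id + DV(y*)` lies in a strip `a < Re μ < b`,
`0 < a ≤ b < 1 + γ`, then `curl V ≡ 0` on a ball around the zero `y*` of `W`.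
[cite: ConstantinIgnatovaVicol2026Putative, §3.5 Prop. 3.9; Khalil2002, §4.3 (4.11) and Thm 4.6] -/
theorem curl_eq_zero_near_charpolySourceNode (hV : ContDiff ℝ ∞ V) {K : ℝ}
    (hK : ∀ y, ‖fderiv ℝ V y‖ ≤ K) (hprof : IsSelfSimilarEulerProfile γ 0 V P)
    {ystar : EuclideanSpace ℝ (Fin 3)} (hstar : selfSimilarTransport γ 0 V ystar = 0)
    {a b : ℝ} (ha : 0 < a) (hab : a ≤ b) (hb : b < 1 + γ)
    (hroots : ∀ μ : ℂ, ((LinearMap.toMatrix (EuclideanSpace.basisFun (Fin 3) ℝ).toBasis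
        (EuclideanSpace.basisFun (Fin 3) ℝ).toBasis
        ((γ • ContinuousLinearMap.id ℝ (EuclideanSpace ℝ (Fin 3)) + fderiv ℝ V ystar :
          EuclideanSpace ℝ (Fin 3) →L[ℝ] EuclideanSpace ℝ (Fin 3)) :
          EuclideanSpace ℝ (Fin 3) →ₗ[ℝ] EuclideanSpace ℝ (Fin 3))).charpoly.map (algebraMap ℝ ℂ)).IsRoot μ →
      a < μ.re ∧ μ.re < b) :
    ∃ r : ℝ, 0 < r ∧ ∀ y : EuclideanSpace ℝ (Fin 3), ‖y - ystar‖ < r → curl V y = 0 := by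
  obtain ⟨ι, T, hι, hspec⟩ := Literature.Analysis.ODE.exists_complexification
    (γ • ContinuousLinearMap.id ℝ (EuclideanSpace ℝ (Fin 3)) + fderiv ℝ V ystar)
  exact curl_eq_zero_near_spectralSourceNode hV hK hprof hstar ι T hι ha hab hb
    fun μ hμ => hroots μ ((hspec μ).1 hμ)

/-- **No vorticity near a HYPERBOLIC SOURCE, `γ < 1/2`.**  If `y*` is a zero of `W = γy + V` at which
every complex root of the characteristic polynomial of `A = γ·id + DV(y*)` has POSITIVE real part
(a hyperbolic source of the transport field), then `curl V ≡ 0` on a ball around `y*`.  Indeed the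
three roots sum to `tr A = 3γ + div V(y*) = 3γ` (`V` is divergence free), so each has
`0 < Re μ < 3γ < 1 + γ`, and `curl_eq_zero_near_charpolySourceNode` applies with
`a = min Re μ / 2`, `b = (max Re μ + 3γ)/2`.  Consequently a classical self-similar profile refuting the
crux in the window `γ < 1/2` has no hyperbolic-source stagnation point in the closure of `{Ω ≠ 0}`.
[cite: ConstantinIgnatovaVicol2026Putative, §3.5 Prop. 3.9; Khalil2002, §4.3 (4.11) and Thm 4.6] -/
theorem curl_eq_zero_near_hyperbolicSourceNode (hγ : γ < 1 / 2) (hV : ContDiff ℝ ∞ V) {K : ℝ}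
    (hK : ∀ y, ‖fderiv ℝ V y‖ ≤ K) (hprof : IsSelfSimilarEulerProfile γ 0 V P)
    {ystar : EuclideanSpace ℝ (Fin 3)} (hstar : selfSimilarTransport γ 0 V ystar = 0)
    (hsource : ∀ μ : ℂ, ((LinearMap.toMatrix (EuclideanSpace.basisFun (Fin 3) ℝ).toBasis
        (EuclideanSpace.basisFun (Fin 3) ℝ).toBasis
        ((γ • ContinuousLinearMap.id ℝ (EuclideanSpace ℝ (Fin 3)) + fderiv ℝ V ystar :
          EuclideanSpace ℝ (Fin 3) →L[ℝ] EuclideanSpace ℝ (Fin 3)) :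
          EuclideanSpace ℝ (Fin 3) →ₗ[ℝ] EuclideanSpace ℝ (Fin 3))).charpoly.map (algebraMap ℝ ℂ)).IsRoot μ →
      0 < μ.re) :
    ∃ r : ℝ, 0 < r ∧ ∀ y : EuclideanSpace ℝ (Fin 3), ‖y - ystar‖ < r → curl V y = 0 := by
  set A : EuclideanSpace ℝ (Fin 3) →L[ℝ] EuclideanSpace ℝ (Fin 3) :=
    γ • ContinuousLinearMap.id ℝ (EuclideanSpace ℝ (Fin 3)) + fderiv ℝ V ystar with hA
  set M : Matrix (Fin 3) (Fin 3) ℝ := LinearMap.toMatrix (EuclideanSpace.basisFun (Fin 3) ℝ).toBasis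
    (EuclideanSpace.basisFun (Fin 3) ℝ).toBasis
    (A : EuclideanSpace ℝ (Fin 3) →ₗ[ℝ] EuclideanSpace ℝ (Fin 3)) with hM
  set χ : Polynomial ℂ := M.charpoly.map (algebraMap ℝ ℂ) with hχ
  -- `χ` is the characteristic polynomial of the complexified matrix: it splits with 3 roots summing
  -- to `tr A = 3γ`
  have hχ' : χ = (M.map (algebraMap ℝ ℂ)).charpoly := by rw [hχ, Matrix.charpoly_map]
  have hχ0 : χ ≠ 0 := ((Matrix.charpoly_monic M).map (algebraMap ℝ ℂ)).ne_zero
  have hsplit : χ.Splits := IsAlgClosed.splits χ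
  have hcard : χ.roots.card = 3 := by
    rw [← hsplit.natDegree_eq_card_roots, hχ', Matrix.charpoly_natDegree_eq_dim, Fintype.card_fin]
  have htrA : LinearMap.trace ℝ _ (A : EuclideanSpace ℝ (Fin 3) →ₗ[ℝ] EuclideanSpace ℝ (Fin 3)) = 3 * γ := by
    have hdiv : LinearMap.trace ℝ _ (fderiv ℝ V ystar : EuclideanSpace ℝ (Fin 3) →ₗ[ℝ]
        EuclideanSpace ℝ (Fin 3)) = 0 := hprof.divFree ystar
    have e : (A : EuclideanSpace ℝ (Fin 3) →ₗ[ℝ] EuclideanSpace ℝ (Fin 3)) =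
        γ • LinearMap.id + (fderiv ℝ V ystar : EuclideanSpace ℝ (Fin 3) →ₗ[ℝ] EuclideanSpace ℝ (Fin 3)) :=
      rfl
    rw [e, map_add, map_smul, hdiv, LinearMap.trace_id, finrank_euclideanSpace_fin, smul_eq_mul]
    push_cast; ring
  have htrace : χ.roots.sum = ((3 * γ : ℝ) : ℂ) := by
    have hs' : (M.map (algebraMap ℝ ℂ)).charpoly.Splits := hχ' ▸ hsplit
    rw [hχ', ← Matrix.trace_eq_sum_roots_charpoly_of_splits hs',
      ← AddMonoidHom.map_trace (algebraMap ℝ ℂ) M, hM, ← LinearMap.trace_eq_matrix_trace, htrA]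
    rfl
  have hmem : ∀ μ : ℂ, μ ∈ χ.roots ↔ χ.IsRoot μ := fun μ => Polynomial.mem_roots hχ0
  -- each root has `Re μ < 3γ`
  have hlt : ∀ μ ∈ χ.roots, μ.re < 3 * γ := by
    intro μ hμ
    have hsum : μ + (χ.roots.erase μ).sum = χ.roots.sum := by
      rw [← Multiset.sum_cons, Multiset.cons_erase hμ]
    have hcard' : (χ.roots.erase μ).card = 2 := by
      rw [Multiset.card_erase_of_mem hμ, hcard]; rfl
    obtain ⟨ν, hν⟩ : ∃ ν, ν ∈ χ.roots.erase μ :=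
      Multiset.card_pos_iff_exists_mem.1 (by rw [hcard']; norm_num)
    have hpos : ∀ ρ ∈ χ.roots.erase μ, 0 < ρ.re := fun ρ hρ =>
      hsource ρ ((hmem ρ).1 (Multiset.mem_of_mem_erase hρ))
    have hre_sum : 0 < ((χ.roots.erase μ).map Complex.re).sum := by
      rw [← Multiset.cons_erase hν, Multiset.map_cons, Multiset.sum_cons]
      have h0 : 0 ≤ (((χ.roots.erase μ).erase ν).map Complex.re).sum :=
        Multiset.sum_nonneg fun x hx => by
          obtain ⟨ρ, hρ, rfl⟩ := Multiset.mem_map.1 hx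
          exact (hpos ρ (Multiset.mem_of_mem_erase hρ)).le
      linarith [hpos ν hν]
    have hre := congrArg Complex.re hsum
    rw [htrace, Complex.add_re, Complex.ofReal_re, ← Complex.coe_reAddGroupHom,
      AddMonoidHom.map_multiset_sum, Complex.coe_reAddGroupHom] at hre
    linarith
  -- the strip `min Re μ / 2 < Re μ < (max Re μ + 3γ)/2`
  have hne : χ.roots.toFinset.Nonempty := by
    obtain ⟨μ, hμ⟩ : ∃ μ, μ ∈ χ.roots := Multiset.card_pos_iff_exists_mem.1 (by rw [hcard]; norm_num)
    exact ⟨μ, Multiset.mem_toFinset.2 hμ⟩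
  obtain ⟨μmin, hμmin, hmin⟩ := Finset.exists_min_image χ.roots.toFinset Complex.re hne
  obtain ⟨μmax, hμmax, hmax⟩ := Finset.exists_max_image χ.roots.toFinset Complex.re hne
  have hamin : 0 < μmin.re := hsource μmin ((hmem μmin).1 (Multiset.mem_toFinset.1 hμmin))
  have hbmax : μmax.re < 3 * γ := hlt μmax (Multiset.mem_toFinset.1 hμmax)
  have hminmax : μmin.re ≤ μmax.re := hmin μmax hμmax
  refine curl_eq_zero_near_charpolySourceNode hV hK hprof hstar (a := μmin.re / 2)
    (b := (μmax.re + 3 * γ) / 2) (by linarith) (by linarith) (by linarith) fun μ hμroot => ?_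
  have hμF : μ ∈ χ.roots.toFinset := Multiset.mem_toFinset.2 ((hmem μ).2 hμroot)
  exact ⟨by linarith [hmin μ hμF], by linarith [hmax μ hμF]⟩

end Summit.NavierStokesRegularity.NavierStokesRegularity.Theorems.PowerGaugeEulerLiouville.Kelvin
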